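import Literature.NumberTheory.Automorphic.SymplecticSatakeIsomorphismRankOne
import Literature.NumberTheory.Automorphic.SubgroupIndexDevissage
import Literature.NumberTheory.Automorphic.SatakeIsomorphismGLNormalisations
import HarnessLib

/-!
# The classical Satake isomorphism for `SL₂ = Sp₂`: the modulus index EVALUATED (`[B(𝒪) : B(𝒪) ∩ t_mB(𝒪)t_m⁻¹] = q^{2|m|}`),
# `range 𝒮_1 = {f : f_{-k} = q^{2k} f_k}`, and for `q ∈ Rˣ` the residue cardinality: `𝒮_q(T) ∈ R[x^{±1}]^{W}`,
# `𝒮_q : ℋ(SL₂(K), SL₂(𝒪); R) ⥲ R[x^{±1}]^{W}` (Cartier Thm. 4.1; Macdonald V (3.4); Satake 1963)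

Topic `NumberTheory/Automorphic`; namespace `Literature.NumberTheory.Automorphic.SymplecticCartan` (lane `lit-hodgefound`,
Track 2 foundations; seat `lit-hodgefound-p11`, generation 45, row g45-#2).  THEOREMS ONLY: no definition, no named fact, no
instance, no notation.  Sequel of `SymplecticSatakeIsomorphismRankOne` (g44-#8: `range 𝒮_1 = {f : f_m = D(m) f_{-m} (m ≤ 0)}`
with the modulus LEFT AS AN INDEX `D(m) = [B(𝒪) : B(𝒪) ∩ t_mB(𝒪)t_m⁻¹]`) and of the engine `SubgroupIndexDevissage` (g45-#1:
torus removal `[L : L ∩ H] = [U : U ∩ H]` and the count `[{v ≤ exp a} : {v ≤ exp b}] = q^{(a-b)⁺}`).  Here, for a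
`ℤᵐ⁰`-valued field `K` with uniformiser `ϖ` and FINITE residue field `𝓀` of cardinality `q`, the index is evaluated and the
`W`-twist is untwisted.

## The mathematics

`G = Sp₂(K) = SL₂(K)` acting on `K^{inl 0} ⊕ K^{inr 0}`, `K₀ = Sp₂(𝒪)`, `B(K)` = the Borel subgroup of
`SymplecticGroupIwasawa` (matrices `(a 0; c d)` in the `(inl, inr)`-block display, `ad = 1`), `K_P = B(𝒪) = B(K) ∩ K₀`,
`t_m = diag(ϖ^m; ϖ^{-m})` (`a(t_m) = m`).  Conjugation by `t_m` multiplies the `(inr, inl)`-entry by `ϖ^{-2m}`, so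
`t_mB(𝒪)t_m⁻¹ = {(a 0; c d) : a, d ∈ 𝒪ˣ, c ∈ ϖ^{-2m}𝒪}` (`mem_conjAct_borelInt_iff_rank_one`) and, removing the torus
(`B(𝒪) = U(𝒪)·T(𝒪)`, `T(𝒪) ⊆ t_mB(𝒪)t_m⁻¹`, g45-#1) along the one-parameter subgroup `u : c ↦ (1 0; c 1)`, `K → SL₂(K)`,

  **`D(m) = [B(𝒪) : B(𝒪) ∩ t_mB(𝒪)t_m⁻¹] = [U(𝒪) : U(ϖ^{(-2m)⁺}𝒪)] = [𝒪 : ϖ^{(-2m)⁺}𝒪] = q^{(-2m)⁺}`**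

(`relIndex_conjAct_borelInt_eq_pow_rank_one`; `= q^{2|m|}` for `m ≤ 0`, `= 1` for `m ≥ 0`; dually
`[t_mB(𝒪)t_m⁻¹ : B(𝒪) ∩ t_mB(𝒪)t_m⁻¹] = q^{(2m)⁺}`) — the modulus `δ_B(t_m) = |ϖ^{2m}| = q^{-2m}` of Cartier §IV (4.2) /
Macdonald V (2.6) read as an index.  CONSEQUENCES.  (1) g44-#8 becomes the classical statement
**`range 𝒮_1 = {f ∈ R[x^{±1}] : f_{-k} = q^{2k} f_k (k ≥ 0)}`** over every commutative ring `R`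
(`range_satakeTransform_one_rank_one_eq_pow`; e.g. `𝒮_1(T_{diag(ϖ;ϖ⁻¹)}) = x + (q-1) + q² x⁻¹`).  (2) For Cartier's
normalisation `𝒮_q = twist_{q^{⟨ρ,·⟩}} ∘ 𝒮_1` (`symplecticSatakeTransform hϖ q`, `⟨ρ, m⟩ = m`) with the parameter
`q ∈ Rˣ` EQUAL to the residue cardinality in `R`, the duality of g44-#4 reads `𝒮_q(T)_m q^{-m} q^{(2m)⁺} = 𝒮_q(T)_{-m} q^{m} q^{(-2m)⁺}`,
and `-m + (2m)⁺ = m + (-2m)⁺ = |m|`, so **`𝒮_q(T)_{-m} = 𝒮_q(T)_m` for every `T` and `m`**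
(`coeff_symplecticSatakeTransform_neg_rank_one`): the Satake transform of every Hecke operator is an honest `W = {±1}`-invariant
Laurent polynomial, and **`range 𝒮_q = R[x^{±1}]^W = {g : g_{-m} = g_m}`** (`range_symplecticSatakeTransform_rank_one`:
`⊇` by untwisting a symmetric `g` into `V` and g44-#8), **`𝒮_q : ℋ(SL₂(K), SL₂(𝒪); R) ⥲ R[x^{±1}]^W`**
(`symplecticSatakeTransform_bijective_rank_one`, injectivity from the tree) — Cartier's Theorem 4.1 («`S` is an isomorphism of
`ℋ(G, K)` onto `ℂ[Λ]^W`») for `SL₂`, over every commutative ring in which `q` is invertible (no `√q` is needed: `SL₂` is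
simply connected, `δ^{1/2}(t_m) = q^{-m}` is integral).

## What is formalised (theorems only)

* §1 (any index type `l`) `fromBlocks_one_zero_mul_fromBlocks_one_zero` (`u(C)u(C') = u(C+C')`),
  `fromBlocks_one_zero_mem_symplecticGroup` (`u(C) ∈ Sp` for `C` symmetric); (`n = 1`) `sub_eq_one_of_mem_symplecticGroup_rank_one`
  (`ad - bc = 1`), `mem_symplecticBorel_iff_rank_one` (`b = 0`), `mem_borelInt_iff_rank_one`, `mem_conjAct_borelInt_iff_rank_one`.
* §2 **`relIndex_conjAct_borelInt_eq_pow_rank_one`** (`[B(𝒪) : B(𝒪) ∩ t_mB(𝒪)t_m⁻¹] = q^{(-2m)⁺}`),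
  **`relIndex_borelInt_conjAct_eq_pow_rank_one`** (`[t_mB(𝒪)t_m⁻¹ : B(𝒪) ∩ t_mB(𝒪)t_m⁻¹] = q^{(2m)⁺}`).
* §3 **`range_satakeTransform_one_rank_one_eq_pow`** (`range 𝒮_1 = {f : f_m = q^{(-2m)⁺} f_{-m} (m ≤ 0)}`),
  **`coeff_symplecticSatakeTransform_neg_rank_one`** (`𝒮_q(T)_{-μ} = 𝒮_q(T)_μ`),
  `domCongr_neg_symplecticSatakeTransform_rank_one` (`ι(𝒮_q T) = 𝒮_q T`), `symplecticSatakeWeight_mul_symplecticSatakeWeight_inv`,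
  **`range_symplecticSatakeTransform_rank_one`** (`range 𝒮_q = {g : g_{-μ} = g_μ}`),
  **`symplecticSatakeTransform_bijective_rank_one`** (`𝒮_q : ℋ ⥲ R[ℤ¹]^W`).

## References
* [CartierCorvallis1979] P. Cartier, *Representations of 𝔭-adic groups: a survey*, PSPM 33.1 (1979), §I.3, §IV (4.2), Thm. 4.1.
* [Macdonald1995] I. G. Macdonald, *Symmetric Functions and Hall Polynomials*, 2nd ed. (1995), Ch. V (2.6)–(2.9), (3.4).
* [Satake1963] I. Satake, *Theory of spherical functions on reductive algebraic groups over 𝔭-adic fields*, Publ. Math. IHÉS 18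
  (1963), §§6–7.
* [Laumon1995] G. Laumon, *Cohomology of Drinfeld Modular Varieties I*, CUP (1996), (4.1.3)–(4.1.6).
* [Serre1979] J.-P. Serre, *Local Fields*, GTM 67 (1979), Ch. II §3.
-/

noncomputable section

open scoped Valued WithZero Pointwise
open Matrix MonoidAlgebra Representation Finset MulAction ConjAct

namespace Literature.NumberTheory.Automorphic.SymplecticCartan

open Literature.NumberTheory.Automorphic.CartanUnique Literature.NumberTheory.Automorphic.HermitianLattice

variable {K : Type*} [Field K] [Valued K ℤᵐ⁰] {ϖ : K}

/-! ## §1 Lower Siegel unipotents; `SL₂` bookkeeping -/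

omit [Valued K ℤᵐ⁰] in
/-- `u(C) u(C') = u(C + C')` for the lower unipotents `u(C) = (1 0; C 1)`. [cite: Macdonald1995, Ch. V (2.6)] -/
theorem fromBlocks_one_zero_mul_fromBlocks_one_zero {l : Type*} [Fintype l] [DecidableEq l] (C C' : Matrix l l K) :
    Matrix.fromBlocks (1 : Matrix l l K) (0 : Matrix l l K) C (1 : Matrix l l K) *
        Matrix.fromBlocks (1 : Matrix l l K) (0 : Matrix l l K) C' (1 : Matrix l l K) =
      Matrix.fromBlocks (1 : Matrix l l K) (0 : Matrix l l K) (C + C') (1 : Matrix l l K) := by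
  rw [Matrix.fromBlocks_multiply]
  simp only [Matrix.one_mul, Matrix.mul_one, Matrix.zero_mul, Matrix.mul_zero, add_zero, zero_add]

omit [Valued K ℤᵐ⁰] in
/-- **`u(C) = (1 0; C 1) ∈ Sp(J, K)` for `C` symmetric** (the unipotent radical of the opposite Siegel parabolic:
`u(C) J u(C)ᵀ = (0 -1; 1 Cᵀ - C)`). [cite: AndrianovZhuravlev1995, Ch. 1 §3 Prop. 3.7] [cite: Macdonald1995, Ch. V (2.6)] -/
theorem fromBlocks_one_zero_mem_symplecticGroup {l : Type*} [Fintype l] [DecidableEq l] {C : Matrix l l K}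
    (hC : C.IsSymm) : Matrix.fromBlocks (1 : Matrix l l K) (0 : Matrix l l K) C (1 : Matrix l l K) ∈ symplecticGroup l K := by
  rw [SymplecticGroup.mem_iff, Matrix.J, Matrix.fromBlocks_transpose, Matrix.fromBlocks_multiply,
    Matrix.fromBlocks_multiply]
  simp only [Matrix.one_mul, Matrix.mul_one, Matrix.zero_mul, Matrix.mul_zero, add_zero, zero_add, Matrix.transpose_one,
    Matrix.transpose_zero, Matrix.mul_neg, hC.eq, add_neg_cancel]

omit [Valued K ℤᵐ⁰] in
/-- **`SL₂ = Sp₂`**: for `g ∈ Sp₂(K)`, `g_{inl,inl} g_{inr,inr} - g_{inl,inr} g_{inr,inl} = 1` (the `(inl, inr)`-entry of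
`g J gᵀ = J`). [cite: AndrianovZhuravlev1995, Ch. 1 §3 (the case `n = 1`)] -/
theorem sub_eq_one_of_mem_symplecticGroup_rank_one (g : symplecticGroup (Fin 1) K) :
    (g : Matrix (Fin 1 ⊕ Fin 1) (Fin 1 ⊕ Fin 1) K) (Sum.inl 0) (Sum.inl 0) * (g : Matrix (Fin 1 ⊕ Fin 1) (Fin 1 ⊕ Fin 1) K) (Sum.inr 0) (Sum.inr 0) -
      (g : Matrix (Fin 1 ⊕ Fin 1) (Fin 1 ⊕ Fin 1) K) (Sum.inl 0) (Sum.inr 0) * (g : Matrix (Fin 1 ⊕ Fin 1) (Fin 1 ⊕ Fin 1) K) (Sum.inr 0) (Sum.inl 0) = 1 := by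
  have h := SymplecticGroup.mem_iff.1 g.2
  have h' := congrFun (congrFun h (Sum.inl 0)) (Sum.inr 0)
  simp only [Matrix.mul_apply, Fintype.sum_sum_type, Fin.sum_univ_one, Matrix.transpose_apply, Matrix.J,
    Matrix.fromBlocks_apply₁₁, Matrix.fromBlocks_apply₁₂, Matrix.fromBlocks_apply₂₁, Matrix.fromBlocks_apply₂₂,
    Matrix.zero_apply, Matrix.neg_apply, Matrix.one_apply_eq, mul_zero, zero_add, add_zero, mul_neg, mul_one] at h'
  linear_combination -h'

omit [Valued K ℤᵐ⁰] in
/-- For `n = 1` the Borel condition is just `g_{inl,inr} = 0`. [cite: AndrianovZhuravlev1995, Ch. 1 §3 Prop. 3.7] -/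
theorem mem_symplecticBorel_iff_rank_one {g : symplecticGroup (Fin 1) K} :
    g ∈ symplecticBorel 1 K ↔ (g : Matrix (Fin 1 ⊕ Fin 1) (Fin 1 ⊕ Fin 1) K) (Sum.inl 0) (Sum.inr 0) = 0 := by
  rw [mem_symplecticBorel_iff, blockTriangular_symplecticBorelOrder_iff]
  constructor
  · rintro ⟨h, -, -⟩
    exact h 0 0
  · intro h
    refine ⟨fun i j => ?_, fun i j hij => absurd hij (by omega), fun i j hij => absurd hij (by omega)⟩
    rw [Subsingleton.elim i 0, Subsingleton.elim j 0]
    exact h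

/-- Membership in `B(𝒪) = B(K) ∩ Sp₂(𝒪)` for `n = 1`: `g_{inl,inr} = 0` and the three other entries integral.
[cite: AndrianovZhuravlev1995, Ch. 3 §3 Lemma 3.4] -/
theorem mem_borelInt_iff_rank_one {g : symplecticGroup (Fin 1) K} :
    g ∈ symplecticBorel 1 K ⊓ symplecticInt (Fin 1) K ↔
      (g : Matrix (Fin 1 ⊕ Fin 1) (Fin 1 ⊕ Fin 1) K) (Sum.inl 0) (Sum.inr 0) = 0 ∧
        Valued.v ((g : Matrix (Fin 1 ⊕ Fin 1) (Fin 1 ⊕ Fin 1) K) (Sum.inl 0) (Sum.inl 0)) ≤ 1 ∧ Valued.v ((g : Matrix (Fin 1 ⊕ Fin 1) (Fin 1 ⊕ Fin 1) K) (Sum.inr 0) (Sum.inl 0)) ≤ 1 ∧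
          Valued.v ((g : Matrix (Fin 1 ⊕ Fin 1) (Fin 1 ⊕ Fin 1) K) (Sum.inr 0) (Sum.inr 0)) ≤ 1 := by
  rw [Subgroup.mem_inf, mem_symplecticBorel_iff_rank_one, mem_symplecticInt_iff]
  constructor
  · rintro ⟨h0, h⟩
    exact ⟨h0, h _ _, h _ _, h _ _⟩
  · rintro ⟨h0, h₁, h₂, h₃⟩
    refine ⟨h0, ?_⟩
    rintro (i | i) (j | j) <;> rw [Subsingleton.elim i 0, Subsingleton.elim j 0]
    · exact h₁
    · rw [h0, map_zero]; exact zero_le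
    · exact h₂
    · exact h₃

/-- **`t_mB(𝒪)t_m⁻¹` for `n = 1`**: `g ∈ t_mB(𝒪)t_m⁻¹` iff `g_{inl,inr} = 0`, `g_{inl,inl}, g_{inr,inr} ∈ 𝒪` and
`v(g_{inr,inl}) ≤ exp(2m)` (conjugation by `t_m⁻¹` multiplies the `(inr, inl)`-entry by `ϖ^{2m}`).
[cite: CartierCorvallis1979, §IV (4.2)] [cite: Macdonald1995, Ch. V (2.6)] -/
theorem mem_conjAct_borelInt_iff_rank_one (hϖ : Valued.v ϖ = WithZero.exp (-1 : ℤ)) {t : symplecticGroup (Fin 1) K} {m : ℤ}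
    (ht : (t : Matrix (Fin 1 ⊕ Fin 1) (Fin 1 ⊕ Fin 1) K) =
      Matrix.diagonal fun s => ϖ ^ Sum.elim (fun _ : Fin 1 => m) (-fun _ : Fin 1 => m) s)
    {g : symplecticGroup (Fin 1) K} :
    g ∈ toConjAct t • (symplecticBorel 1 K ⊓ symplecticInt (Fin 1) K) ↔
      (g : Matrix (Fin 1 ⊕ Fin 1) (Fin 1 ⊕ Fin 1) K) (Sum.inl 0) (Sum.inr 0) = 0 ∧
        Valued.v ((g : Matrix (Fin 1 ⊕ Fin 1) (Fin 1 ⊕ Fin 1) K) (Sum.inl 0) (Sum.inl 0)) ≤ 1 ∧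
          Valued.v ((g : Matrix (Fin 1 ⊕ Fin 1) (Fin 1 ⊕ Fin 1) K) (Sum.inr 0) (Sum.inl 0)) ≤ WithZero.exp (2 * m) ∧
            Valued.v ((g : Matrix (Fin 1 ⊕ Fin 1) (Fin 1 ⊕ Fin 1) K) (Sum.inr 0) (Sum.inr 0)) ≤ 1 := by
  have hϖ0 := uniformizer_ne_zero hϖ
  have ht' := coe_inv_eq_diagonal_zpow_neg hϖ ht
  rw [Subgroup.mem_pointwise_smul_iff_inv_smul_mem, ← toConjAct_inv, toConjAct_smul, mem_borelInt_iff_rank_one]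
  simp only [coe_conj_apply_of_coe_eq_diagonal_zpow hϖ0 ht', Sum.elim_inl, Sum.elim_inr, Pi.neg_apply, neg_neg,
    sub_self, zpow_zero, one_mul, map_mul, v_uniformizer_zpow hϖ]
  have e : -m - m = -(2 * m) := by ring
  have e' : -(m - -m) = -(2 * m) := by ring
  rw [e, e', mul_eq_zero, or_iff_right (zpow_ne_zero _ hϖ0)]
  refine and_congr_right fun _ => and_congr_right fun _ => and_congr_left fun _ => ?_
  constructor
  · intro h
    have h' := mul_le_mul_right h (WithZero.exp (2 * m))
    rwa [← mul_assoc, ← WithZero.exp_add, add_neg_cancel, WithZero.exp_zero, one_mul, mul_one] at h'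
  · intro h
    have h' := mul_le_mul_right h (WithZero.exp (-(2 * m)))
    rwa [← WithZero.exp_add, neg_add_cancel, WithZero.exp_zero] at h'

/-! ## §2 The modulus index of `SL₂` evaluated: `[B(𝒪) : B(𝒪) ∩ t_mB(𝒪)t_m⁻¹] = q^{(-2m)⁺}` -/

/-- **THE MODULUS OF THE BOREL OF `SL₂` AS AN INDEX**: for every `m ∈ ℤ`,
`[B(𝒪) : B(𝒪) ∩ t_mB(𝒪)t_m⁻¹] = q^{(-2m)⁺}` (`q = #𝓀`; `= q^{2|m|} = δ_B(t_m)^{-1}… ` for `m ≤ 0`, `= 1` for `m ≥ 0`):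
`B(𝒪) = U(𝒪)·T(𝒪)` with `T(𝒪) ⊆ t_mB(𝒪)t_m⁻¹` removes the torus (g45-#1), and along `u : c ↦ (1 0; c 1)` the unipotent
index is `[𝒪 : ϖ^{(-2m)⁺}𝒪] = q^{(-2m)⁺}`. [cite: CartierCorvallis1979, §I.3, §IV (4.2)] [cite: Macdonald1995, Ch. V (2.6)]
[cite: Laumon1995, (4.1.4)] -/
theorem relIndex_conjAct_borelInt_eq_pow_rank_one (hϖ : Valued.v ϖ = WithZero.exp (-1 : ℤ)) [Finite 𝓀[K]]
    {t : symplecticGroup (Fin 1) K} {m : ℤ}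
    (ht : (t : Matrix (Fin 1 ⊕ Fin 1) (Fin 1 ⊕ Fin 1) K) =
      Matrix.diagonal fun s => ϖ ^ Sum.elim (fun _ : Fin 1 => m) (-fun _ : Fin 1 => m) s) :
    (toConjAct t • (symplecticBorel 1 K ⊓ symplecticInt (Fin 1) K)).relIndex (symplecticBorel 1 K ⊓ symplecticInt (Fin 1) K) =
      Nat.card 𝓀[K] ^ (-(2 * m)).toNat := by
  have hϖ0 := uniformizer_ne_zero hϖ
  -- the one-parameter subgroup `u : c ↦ (1 0; c 1)`
  let u : Multiplicative K →* symplecticGroup (Fin 1) K :=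
    { toFun := fun c => ⟨Matrix.fromBlocks (1 : Matrix (Fin 1) (Fin 1) K) (0 : Matrix (Fin 1) (Fin 1) K) (Multiplicative.toAdd c • (1 : Matrix (Fin 1) (Fin 1) K)) (1 : Matrix (Fin 1) (Fin 1) K),
        fromBlocks_one_zero_mem_symplecticGroup ((Matrix.isSymm_one).smul _)⟩
      map_one' := Subtype.ext (by
        change Matrix.fromBlocks (1 : Matrix (Fin 1) (Fin 1) K) (0 : Matrix (Fin 1) (Fin 1) K) (Multiplicative.toAdd (1 : Multiplicative K) • (1 : Matrix (Fin 1) (Fin 1) K)) (1 : Matrix (Fin 1) (Fin 1) K) = 1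
        rw [toAdd_one, zero_smul, Matrix.fromBlocks_one])
      map_mul' := fun a b => Subtype.ext (by
        change Matrix.fromBlocks (1 : Matrix (Fin 1) (Fin 1) K) (0 : Matrix (Fin 1) (Fin 1) K) (Multiplicative.toAdd (a * b) • (1 : Matrix (Fin 1) (Fin 1) K)) (1 : Matrix (Fin 1) (Fin 1) K) =
          Matrix.fromBlocks (1 : Matrix (Fin 1) (Fin 1) K) (0 : Matrix (Fin 1) (Fin 1) K) (Multiplicative.toAdd a • (1 : Matrix (Fin 1) (Fin 1) K)) (1 : Matrix (Fin 1) (Fin 1) K) *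
            Matrix.fromBlocks (1 : Matrix (Fin 1) (Fin 1) K) (0 : Matrix (Fin 1) (Fin 1) K) (Multiplicative.toAdd b • (1 : Matrix (Fin 1) (Fin 1) K)) (1 : Matrix (Fin 1) (Fin 1) K)
        rw [fromBlocks_one_zero_mul_fromBlocks_one_zero, toAdd_mul, add_smul]) }
  -- entries of `u c`
  have hu : ∀ c : Multiplicative K,
      ((u c : symplecticGroup (Fin 1) K) : Matrix (Fin 1 ⊕ Fin 1) (Fin 1 ⊕ Fin 1) K) (Sum.inl 0) (Sum.inl 0) = 1 ∧
      ((u c : symplecticGroup (Fin 1) K) : Matrix (Fin 1 ⊕ Fin 1) (Fin 1 ⊕ Fin 1) K) (Sum.inl 0) (Sum.inr 0) = 0 ∧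
      ((u c : symplecticGroup (Fin 1) K) : Matrix (Fin 1 ⊕ Fin 1) (Fin 1 ⊕ Fin 1) K) (Sum.inr 0) (Sum.inl 0) = Multiplicative.toAdd c ∧
      ((u c : symplecticGroup (Fin 1) K) : Matrix (Fin 1 ⊕ Fin 1) (Fin 1 ⊕ Fin 1) K) (Sum.inr 0) (Sum.inr 0) = 1 := by
    intro c
    change Matrix.fromBlocks (1 : Matrix (Fin 1) (Fin 1) K) (0 : Matrix (Fin 1) (Fin 1) K) (Multiplicative.toAdd c • (1 : Matrix (Fin 1) (Fin 1) K)) (1 : Matrix (Fin 1) (Fin 1) K) (Sum.inl 0) (Sum.inl 0) = 1 ∧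
      Matrix.fromBlocks (1 : Matrix (Fin 1) (Fin 1) K) (0 : Matrix (Fin 1) (Fin 1) K) (Multiplicative.toAdd c • (1 : Matrix (Fin 1) (Fin 1) K)) (1 : Matrix (Fin 1) (Fin 1) K) (Sum.inl 0) (Sum.inr 0) = 0 ∧
      Matrix.fromBlocks (1 : Matrix (Fin 1) (Fin 1) K) (0 : Matrix (Fin 1) (Fin 1) K) (Multiplicative.toAdd c • (1 : Matrix (Fin 1) (Fin 1) K)) (1 : Matrix (Fin 1) (Fin 1) K) (Sum.inr 0) (Sum.inl 0) = _ ∧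
      Matrix.fromBlocks (1 : Matrix (Fin 1) (Fin 1) K) (0 : Matrix (Fin 1) (Fin 1) K) (Multiplicative.toAdd c • (1 : Matrix (Fin 1) (Fin 1) K)) (1 : Matrix (Fin 1) (Fin 1) K) (Sum.inr 0) (Sum.inr 0) = 1
    rw [Matrix.fromBlocks_apply₁₁, Matrix.fromBlocks_apply₁₂, Matrix.fromBlocks_apply₂₁, Matrix.fromBlocks_apply₂₂,
      Matrix.one_apply_eq, Matrix.zero_apply, Matrix.smul_apply, Matrix.one_apply_eq, smul_eq_mul, mul_one]
    exact ⟨rfl, rfl, rfl, rfl⟩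
  have hu_inj : Function.Injective u := by
    intro a b hab
    have h := congrArg (fun g : symplecticGroup (Fin 1) K => (g : Matrix (Fin 1 ⊕ Fin 1) (Fin 1 ⊕ Fin 1) K) (Sum.inr 0) (Sum.inl 0)) hab
    simp only [(hu a).2.2.1, (hu b).2.2.1] at h
    exact Multiplicative.toAdd.injective h
  -- membership of `u c` in `B(𝒪)` and in `t_mB(𝒪)t_m⁻¹`
  have hu_mem : ∀ c : Multiplicative K, u c ∈ symplecticBorel 1 K ⊓ symplecticInt (Fin 1) K ↔
      Valued.v (Multiplicative.toAdd c) ≤ 1 := by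
    intro c
    rw [mem_borelInt_iff_rank_one, (hu c).1, (hu c).2.1, (hu c).2.2.1, (hu c).2.2.2, map_one]
    exact ⟨fun h => h.2.2.1, fun h => ⟨rfl, le_rfl, h, le_rfl⟩⟩
  have hu_mem' : ∀ c : Multiplicative K, u c ∈ toConjAct t • (symplecticBorel 1 K ⊓ symplecticInt (Fin 1) K) ↔
      Valued.v (Multiplicative.toAdd c) ≤ WithZero.exp (2 * m) := by
    intro c
    rw [mem_conjAct_borelInt_iff_rank_one hϖ ht, (hu c).1, (hu c).2.1, (hu c).2.2.1, (hu c).2.2.2, map_one]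
    exact ⟨fun h => h.2.2.1, fun h => ⟨rfl, le_rfl, h, le_rfl⟩⟩
  -- the subgroups `U(𝒪) = u(𝒪)` and `U(ϖ^{-2m}𝒪) = u(ϖ^{-2m}𝒪)`
  set U₀ : Subgroup (symplecticGroup (Fin 1) K) :=
    (AddSubgroup.toSubgroup ((Valued.v : Valuation K ℤᵐ⁰).leAddSubgroup (WithZero.exp (0 : ℤ)))).map u with hU₀
  set U₁ : Subgroup (symplecticGroup (Fin 1) K) :=
    (AddSubgroup.toSubgroup ((Valued.v : Valuation K ℤᵐ⁰).leAddSubgroup (WithZero.exp (2 * m)))).map u with hU₁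
  have hmemU₀ : ∀ g, g ∈ U₀ ↔ ∃ c : K, Valued.v c ≤ 1 ∧ u (Multiplicative.ofAdd c) = g := by
    intro g
    rw [hU₀, Subgroup.mem_map]
    constructor
    · rintro ⟨c, hc, rfl⟩
      refine ⟨Multiplicative.toAdd c, ?_, rfl⟩
      have hc' : Valued.v (Multiplicative.toAdd c) ≤ WithZero.exp (0 : ℤ) := hc
      rwa [WithZero.exp_zero] at hc'
    · rintro ⟨c, hc, rfl⟩
      refine ⟨Multiplicative.ofAdd c, ?_, rfl⟩
      change Valued.v c ≤ WithZero.exp (0 : ℤ)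
      rwa [WithZero.exp_zero]
  have hmemU₁ : ∀ g, g ∈ U₁ ↔ ∃ c : K, Valued.v c ≤ WithZero.exp (2 * m) ∧ u (Multiplicative.ofAdd c) = g := by
    intro g
    rw [hU₁, Subgroup.mem_map]
    constructor
    · rintro ⟨c, hc, rfl⟩
      exact ⟨Multiplicative.toAdd c, hc, rfl⟩
    · rintro ⟨c, hc, rfl⟩
      exact ⟨Multiplicative.ofAdd c, hc, rfl⟩
  -- (i) `U(𝒪) ≤ B(𝒪)`
  have hUB : U₀ ≤ symplecticBorel 1 K ⊓ symplecticInt (Fin 1) K := by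
    intro g hg
    obtain ⟨c, hc, rfl⟩ := (hmemU₀ g).1 hg
    exact (hu_mem _).2 hc
  -- (ii) `B(𝒪) ⊆ U(𝒪) · t_mB(𝒪)t_m⁻¹`: `(a 0; c d) = u(cd) · (a 0; 0 d)`
  have hBU : ((symplecticBorel 1 K ⊓ symplecticInt (Fin 1) K : Subgroup (symplecticGroup (Fin 1) K)) :
      Set (symplecticGroup (Fin 1) K)) ⊆
      (U₀ : Set (symplecticGroup (Fin 1) K)) * (toConjAct t • (symplecticBorel 1 K ⊓ symplecticInt (Fin 1) K) :
        Subgroup (symplecticGroup (Fin 1) K)) := by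
    intro g hg
    obtain ⟨h0, ha, hc, hd⟩ := mem_borelInt_iff_rank_one.1 hg
    have had := sub_eq_one_of_mem_symplecticGroup_rank_one g
    rw [h0, zero_mul, sub_zero] at had
    set a := (g : Matrix (Fin 1 ⊕ Fin 1) (Fin 1 ⊕ Fin 1) K) (Sum.inl 0) (Sum.inl 0) with ha_def
    set c := (g : Matrix (Fin 1 ⊕ Fin 1) (Fin 1 ⊕ Fin 1) K) (Sum.inr 0) (Sum.inl 0) with hc_def
    set d := (g : Matrix (Fin 1 ⊕ Fin 1) (Fin 1 ⊕ Fin 1) K) (Sum.inr 0) (Sum.inr 0) with hd_def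
    -- `x = c d ∈ 𝒪` and `g = u(x) · (u(x)⁻¹ g)`
    refine Set.mem_mul.2 ⟨u (Multiplicative.ofAdd (c * d)), ?_, (u (Multiplicative.ofAdd (c * d)))⁻¹ * g, ?_,
      by rw [mul_inv_cancel_left]⟩
    · exact (hmemU₀ _).2 ⟨c * d, (map_mul Valued.v c d).le.trans (mul_le_one' hc hd), rfl⟩
    · -- the entries of `u(-cd) g = (a 0; 0 d)`
      have hinv : (u (Multiplicative.ofAdd (c * d)))⁻¹ = u (Multiplicative.ofAdd (-(c * d))) := by
        rw [ofAdd_neg, map_inv]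
      have hprod : ∀ s s', (((u (Multiplicative.ofAdd (-(c * d)))) * g : symplecticGroup (Fin 1) K) :
          Matrix (Fin 1 ⊕ Fin 1) (Fin 1 ⊕ Fin 1) K) s s' =
          ((u (Multiplicative.ofAdd (-(c * d))) : symplecticGroup (Fin 1) K) : Matrix (Fin 1 ⊕ Fin 1) (Fin 1 ⊕ Fin 1) K) s (Sum.inl 0) *
              (g : Matrix (Fin 1 ⊕ Fin 1) (Fin 1 ⊕ Fin 1) K) (Sum.inl 0) s' +
            ((u (Multiplicative.ofAdd (-(c * d))) : symplecticGroup (Fin 1) K) : Matrix (Fin 1 ⊕ Fin 1) (Fin 1 ⊕ Fin 1) K) s (Sum.inr 0) *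
              (g : Matrix (Fin 1 ⊕ Fin 1) (Fin 1 ⊕ Fin 1) K) (Sum.inr 0) s' := by
        intro s s'
        rw [Submonoid.coe_mul, Matrix.mul_apply, Fintype.sum_sum_type, Fin.sum_univ_one, Fin.sum_univ_one]
      obtain ⟨e₁, e₂, e₃, e₄⟩ := hu (Multiplicative.ofAdd (-(c * d)))
      rw [toAdd_ofAdd] at e₃
      refine SetLike.mem_coe.2 ((mem_conjAct_borelInt_iff_rank_one hϖ ht).2 ⟨?_, ?_, ?_, ?_⟩)
      · rw [hinv, hprod, e₁, e₂, h0, one_mul, zero_mul, add_zero]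
      · rw [hinv, hprod, e₁, e₂, one_mul, zero_mul, add_zero]; exact ha
      · rw [hinv, hprod, e₃, e₄, one_mul, ← hc_def, ← ha_def]
        have : -(c * d) * a + c = 0 := by linear_combination -c * had
        rw [this, map_zero]; exact zero_le
      · rw [hinv, hprod, e₃, e₄, h0, mul_zero, zero_add, one_mul]; exact hd
  -- (iii) `t_mB(𝒪)t_m⁻¹ ∩ U(𝒪) = u(ϖ^{-2m}𝒪) ∩ u(𝒪)`
  have hinf : toConjAct t • (symplecticBorel 1 K ⊓ symplecticInt (Fin 1) K) ⊓ U₀ = U₁ ⊓ U₀ := by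
    ext g
    simp only [Subgroup.mem_inf]
    constructor
    · rintro ⟨hg, hgU⟩
      obtain ⟨c, hc, rfl⟩ := (hmemU₀ g).1 hgU
      exact ⟨(hmemU₁ _).2 ⟨c, (hu_mem' _).1 hg, rfl⟩, hgU⟩
    · rintro ⟨hg, hgU⟩
      obtain ⟨c, hc, rfl⟩ := (hmemU₁ g).1 hg
      exact ⟨(hu_mem' _).2 hc, hgU⟩
  -- (iv) assemble: `[B(𝒪) : B(𝒪) ∩ tB(𝒪)t⁻¹] = [U(𝒪) : U(𝒪) ∩ tB(𝒪)t⁻¹] = [u(𝒪) : u(𝒪) ∩ u(ϖ^{-2m}𝒪)] = q^{(-2m)⁺}`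
  rw [relIndex_eq_relIndex_of_coe_subset_mul hUB hBU, ← Subgroup.inf_relIndex_right, hinf, Subgroup.inf_relIndex_right, hU₁, hU₀,
    Subgroup.relIndex_map_map_of_injective _ _ hu_inj, relIndex_toSubgroup_leAddSubgroup_exp hϖ]
  congr 1
  omega

/-- **The dual index**: `[t_mB(𝒪)t_m⁻¹ : B(𝒪) ∩ t_mB(𝒪)t_m⁻¹] = q^{(2m)⁺}` (conjugate by `t_m⁻¹ = t_{-m}`).
[cite: CartierCorvallis1979, §I.3, §IV (4.2)] [cite: Laumon1995, (4.1.4)] -/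
theorem relIndex_borelInt_conjAct_eq_pow_rank_one (hϖ : Valued.v ϖ = WithZero.exp (-1 : ℤ)) [Finite 𝓀[K]]
    {t : symplecticGroup (Fin 1) K} {m : ℤ}
    (ht : (t : Matrix (Fin 1 ⊕ Fin 1) (Fin 1 ⊕ Fin 1) K) =
      Matrix.diagonal fun s => ϖ ^ Sum.elim (fun _ : Fin 1 => m) (-fun _ : Fin 1 => m) s) :
    (symplecticBorel 1 K ⊓ symplecticInt (Fin 1) K).relIndex (toConjAct t • (symplecticBorel 1 K ⊓ symplecticInt (Fin 1) K)) =
      Nat.card 𝓀[K] ^ (2 * m).toNat := by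
  have ht' : ((t⁻¹ : symplecticGroup (Fin 1) K) : Matrix (Fin 1 ⊕ Fin 1) (Fin 1 ⊕ Fin 1) K) =
      Matrix.diagonal fun s => ϖ ^ Sum.elim (fun _ : Fin 1 => -m) (-fun _ : Fin 1 => -m) s := by
    rw [coe_inv_eq_diagonal_zpow_neg hϖ ht]
    rfl
  have h := relIndex_conjAct_borelInt_eq_pow_rank_one hϖ ht'
  rw [toConjAct_inv] at h
  have e := Subgroup.relIndex_pointwise_smul (toConjAct t)⁻¹ (symplecticBorel 1 K ⊓ symplecticInt (Fin 1) K)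
    (toConjAct t • (symplecticBorel 1 K ⊓ symplecticInt (Fin 1) K))
  rw [inv_smul_smul] at e
  rw [← e, h]
  congr 1
  omega

/-! ## §3 The classical Satake isomorphism for `SL₂` -/

section Classical

variable {R : Type*} [CommRing R] (hϖ : Valued.v ϖ = WithZero.exp (-1 : ℤ)) [Finite 𝓀[K]]
  [IsHeckeTriple (⊤ : Submonoid (symplecticGroup (Fin 1) K)) (symplecticInt (Fin 1) K) (symplecticInt (Fin 1) K)]
include hϖ

/-- **`range 𝒮_1 = {f ∈ R[x^{±1}] : f_m = q^{(-2m)⁺} f_{-m} (m ≤ 0)}`** — the image of the COUNTING Satake transform of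
`ℋ(SL₂(K), SL₂(𝒪); R)`, over every commutative ring `R`: g44-#8 with the modulus index evaluated (`f_{-k} = q^{2k} f_k`).
[cite: CartierCorvallis1979, §IV Thm. 4.1] [cite: Macdonald1995, Ch. V (2.6), (3.4)] [cite: Satake1963, §§6–7] -/
theorem range_satakeTransform_one_rank_one_eq_pow :
    Set.range ((isIwasawaExponent_symplectic (n := 1) hϖ).satakeTransform (1 : Multiplicative (Fin 1 → ℤ) →* R)) =
      {f | ∀ m : ℤ, m ≤ 0 → f.coeff (fun _ : Fin 1 => m) = f.coeff (fun _ : Fin 1 => -m) * ((Nat.card 𝓀[K] ^ (-(2 * m)).toNat : ℕ) : R)} := by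
  rw [range_satakeTransform_one_rank_one hϖ]
  ext f
  simp only [Set.mem_setOf_eq]
  refine forall_congr' fun m => imp_congr_right fun _ => ?_
  rw [relIndex_conjAct_borelInt_eq_pow_rank_one hϖ rfl]

/-- **`𝒮_q(T)_{-μ} = 𝒮_q(T)_μ`**: when the parameter `q ∈ Rˣ` is the residue cardinality, Cartier's normalised Satake transform
of EVERY `T ∈ ℋ(SL₂(K), SL₂(𝒪); R)` is `W = {±1}`-invariant (duality of g44-#4 with both indices evaluated:
`c_μ q^{-m} q^{(2m)⁺} = c_{-μ} q^{m} q^{(-2m)⁺}`, `m = μ 0`, and `-m + (2m)⁺ = m + (-2m)⁺`).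
[cite: CartierCorvallis1979, §IV (4.2), Thm. 4.1] [cite: Macdonald1995, Ch. V (3.4)] -/
theorem coeff_symplecticSatakeTransform_neg_rank_one (q : Rˣ) (hq : (q : R) = Nat.card 𝓀[K])
    (T : heckeAlgebra R (symplecticGroup (Fin 1) K) (symplecticInt (Fin 1) K)) (μ : Fin 1 → ℤ) :
    (symplecticSatakeTransform hϖ q T).coeff (-μ) = (symplecticSatakeTransform hϖ q T).coeff μ := by
  have hμ : μ = fun _ : Fin 1 => μ 0 := eq_const_of_fin_one μ
  obtain ⟨t, ht⟩ := exists_coe_eq_diagonal_zpow_symplectic (K := K) (uniformizer_ne_zero hϖ) (fun _ : Fin 1 => μ 0)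
  have key := coeff_symplecticSatakeTransform_mul_relIndex_eq hϖ q T ht
  rw [relIndex_borelInt_conjAct_eq_pow_rank_one hϖ ht, relIndex_conjAct_borelInt_eq_pow_rank_one hϖ ht, ← hμ,
    symplecticRhoPairing_one, symplecticRhoPairing_one, Pi.neg_apply, Nat.cast_pow, Nat.cast_pow, ← hq,
    ← Units.val_pow_eq_pow_val, ← Units.val_pow_eq_pow_val, mul_assoc, mul_assoc, ← Units.val_mul, ← Units.val_mul,
    ← zpow_natCast, ← zpow_natCast, ← _root_.zpow_add, ← _root_.zpow_add] at key
  have e : -μ 0 + ((2 * μ 0).toNat : ℤ) = μ 0 + ((-(2 * μ 0)).toNat : ℤ) := by omega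
  rw [e] at key
  exact (Units.mul_left_inj _).1 key.symm

/-- `ι(𝒮_q T) = 𝒮_q T` for `ι(x^μ) = x^{-μ}`: the whole Satake image of `ℋ(SL₂)` is `W`-invariant.
[cite: CartierCorvallis1979, §IV Thm. 4.1] -/
theorem domCongr_neg_symplecticSatakeTransform_rank_one (q : Rˣ) (hq : (q : R) = Nat.card 𝓀[K])
    (T : heckeAlgebra R (symplecticGroup (Fin 1) K) (symplecticInt (Fin 1) K)) :
    AddMonoidAlgebra.domCongr R R (AddEquiv.neg (Fin 1 → ℤ)) (symplecticSatakeTransform hϖ q T) =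
      symplecticSatakeTransform hϖ q T := by
  refine AddMonoidAlgebra.ext (Finsupp.ext fun μ => ?_)
  rw [IsIwasawaExponent.coeff_domCongr_neg, coeff_symplecticSatakeTransform_neg_rank_one hϖ q hq]

omit hϖ [Valued K ℤᵐ⁰] [Finite 𝓀[K]]
  [IsHeckeTriple (⊤ : Submonoid (symplecticGroup (Fin 1) K)) (symplecticInt (Fin 1) K) (symplecticInt (Fin 1) K)] in
/-- The weights `q^{⟨ρ,·⟩}` and `q^{-⟨ρ,·⟩}` are mutually inverse (any `n`). [cite: CartierCorvallis1979, §IV (4.2)] -/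
theorem symplecticSatakeWeight_mul_symplecticSatakeWeight_inv {n : ℕ} (q : Rˣ) (l : Multiplicative (Fin n → ℤ)) :
    symplecticSatakeWeight q l * symplecticSatakeWeight q⁻¹ l = 1 := by
  rw [← ofAdd_toAdd l, symplecticSatakeWeight_ofAdd, symplecticSatakeWeight_ofAdd, ← Units.val_mul, ← mul_zpow,
    mul_inv_cancel, _root_.one_zpow, Units.val_one]

/-- **`range 𝒮_q = R[x^{±1}]^W = {g : g_{-μ} = g_μ}`** for `q ∈ Rˣ` the residue cardinality: `⊆` by the `W`-invariance of every
transform, `⊇` because the untwist `f = twist_{q^{-⟨ρ,·⟩}} g` of a symmetric `g` satisfies `f_m = q^{(-2m)⁺} f_{-m}` (`m ≤ 0`),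
hence `f = 𝒮_1(T)` (g44-#8) and `𝒮_q(T) = twist_q f = g`. [cite: CartierCorvallis1979, §IV Thm. 4.1]
[cite: Satake1963, §§6–7] [cite: Macdonald1995, Ch. V (3.4)] -/
theorem range_symplecticSatakeTransform_rank_one (q : Rˣ) (hq : (q : R) = Nat.card 𝓀[K]) :
    Set.range (symplecticSatakeTransform (n := 1) (R := R) hϖ q) = {g | ∀ μ : Fin 1 → ℤ, g.coeff (-μ) = g.coeff μ} := by
  ext g
  constructor
  · rintro ⟨T, rfl⟩ μ
    exact coeff_symplecticSatakeTransform_neg_rank_one hϖ q hq T μ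
  · intro hg
    -- untwist
    set f := monomialTwist (symplecticSatakeWeight (n := 1) q⁻¹) g with hf
    have hfV : f ∈ Set.range ((isIwasawaExponent_symplectic (n := 1) hϖ).satakeTransform (1 : Multiplicative (Fin 1 → ℤ) →* R)) := by
      rw [range_satakeTransform_one_rank_one_eq_pow hϖ]
      intro m hm
      rw [hf, coeff_monomialTwist, coeff_monomialTwist, symplecticSatakeWeight_ofAdd, symplecticSatakeWeight_ofAdd,
        symplecticRhoPairing_one, symplecticRhoPairing_one]
      have hsymm : g.coeff (fun _ : Fin 1 => -m) = g.coeff (fun _ : Fin 1 => m) := hg (fun _ : Fin 1 => m)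
      rw [hsymm, Nat.cast_pow, ← hq, ← Units.val_pow_eq_pow_val, ← zpow_natCast, mul_right_comm, ← Units.val_mul]
      congr 2
      rw [_root_.inv_zpow', _root_.inv_zpow', neg_neg, ← _root_.zpow_add]
      congr 1
      omega
    obtain ⟨T, hT⟩ := hfV
    refine ⟨T, ?_⟩
    rw [symplecticSatakeTransform_eq_monomialTwist_comp, AlgHom.comp_apply, hT, hf]
    exact monomialTwist_monomialTwist_of_mul_eq_one _ _ (symplecticSatakeWeight_mul_symplecticSatakeWeight_inv q) g

/-- **THE SATAKE ISOMORPHISM FOR `SL₂` (Cartier's Theorem 4.1 verbatim in rank one)**: for `q ∈ Rˣ` the residue cardinality,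
`𝒮_q` is a bijection of `ℋ(SL₂(K), SL₂(𝒪); R)` onto the `W`-invariant Laurent polynomials `{g ∈ R[x^{±1}] : g_{-μ} = g_μ}`, for
every commutative ring `R` in which `q` is invertible. [cite: CartierCorvallis1979, §IV Thm. 4.1] [cite: Satake1963, §§6–7]
[cite: Macdonald1995, Ch. V (3.4)] -/
theorem symplecticSatakeTransform_bijective_rank_one (q : Rˣ) (hq : (q : R) = Nat.card 𝓀[K]) :
    Function.Bijective (fun T : heckeAlgebra R (symplecticGroup (Fin 1) K) (symplecticInt (Fin 1) K) =>
      (⟨symplecticSatakeTransform hϖ q T, fun μ => coeff_symplecticSatakeTransform_neg_rank_one hϖ q hq T μ⟩ :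
        {g : AddMonoidAlgebra R (Fin 1 → ℤ) // ∀ μ : Fin 1 → ℤ, g.coeff (-μ) = g.coeff μ})) := by
  refine ⟨fun T T' h => symplecticSatakeTransform_injective_of_commRing hϖ q (congrArg Subtype.val h), fun g => ?_⟩
  have hg : (g : AddMonoidAlgebra R (Fin 1 → ℤ)) ∈ Set.range (symplecticSatakeTransform (n := 1) (R := R) hϖ q) := by
    rw [range_symplecticSatakeTransform_rank_one hϖ q hq]
    exact g.2
  obtain ⟨T, hT⟩ := hg
  exact ⟨T, Subtype.ext hT⟩

end Classical

end Literature.NumberTheory.Automorphic.SymplecticCartan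

end
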